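import Summits.BirchSwinnertonDyer.Rank1Residual.P2.KrizLiJZeroBasesMembership
import Mathlib.Tactic.NormNum.LegendreSymbol
import HarnessLib

/-!
# Cell `bsd-print-cf2` (D-0131 (2) PRINT TIER, leaf CornerF @ `p = 2`), typer ty2 — EXPLICIT MEMBERS of
# the Kriz–Li families of the (★)-certified bases `1323a1`, `1323m1` (field `ℚ(√−47)`) and `4563a1`
# (field `ℚ(√−23)`): `d = 61, 61, 193` decided in the kernel, and `BSD(W′, 2)` BY NAME on their classes

HONEST FRAMING. End-to-end check of the DISCHARGE INTERFACE (ty2) at one explicit twist per base: the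
index sets `𝒩(E, K)` of Kriz–Li Def 4.1 are DECIDED in the kernel (`inN_curveX_of_explicit`, p565872:
`d ≡ 1 (mod 4)` square-free, every prime `ℓ ∣ d` outside `2N`, split in `K`, with `a_ℓ(E)` odd ⟺ an even
number of cube roots of `−16(4a+1)` in `𝔽_ℓ`), so for the smallest admissible prime `d` of each certified
pair — `61 ∈ 𝒩(1323a1, ℚ(√−47))`, `61 ∈ 𝒩(1323m1, ℚ(√−47))`, `193 ∈ 𝒩(4563a1, ℚ(√−23))` (each `≡ 1 (mod 12)`,
prime to `q = 7, 13`, so `χ_d(−N) = +1` by the settings' sign clause) — every globally minimal `W′`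
`ℚ`-isogenous to `E^{(d)}` or to `E^{(d·d_K)}` satisfies `BSD(W′, 2)` from prover p3's generic door
`bsdp_two_of_isIsogenousToKrizLiTwistOfSmallCMBase` granted BY NAME the seven facts `hKL h33 hS31 hBF hmod
hGZK hCassels` (conjuncts of `𝔅_inert` + asides 20767/20768) and the DISPLAYED (★)-datum
`hSD : HasKrizLiStarDatum curveX (sqrtField d_K)` — a CERTIFICATE (cell dossier §14.4/§14.8: exact Heegner
index and `2`-adic logarithm units for these pairs), NOT print; currency LITERAL-by-name((★)-display).
The fields are the tree's models `sqrtField (−47)` / `sqrtField (−23)` (`d_K = −47`, `−23` proved in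
`KrizLiThirteenTwentyThree` / p3's `KrizLiTwoFortyThreeCurve`). Pattern = p3's printed member
`bsdp_two_twist_thirteen_curve243a1`. No named fact; nothing asserted; the leaf is OPEN AS A CLASS;
beyond print: NO.

References: [KrizLi2019] Thm 5.1 (2) = arXiv:1606.03172 Thm 1.12, Def 4.1, §6 Ex. 6.2, Rem. 6.3;
[Cremona1997] Table 1 (1323a1, 1323m1, 4563a1); cell dossier §14.4, §14.8 (certified pairs).
-/

noncomputable section

open scoped Classical

open WeierstrassCurve NumberField Literature.NumberTheory.EllipticCurves
  Literature.NumberTheory.EllipticCurves.Rank1Residual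
  Literature.NumberTheory.EllipticCurves.ModularForms
  Summit.BirchSwinnertonDyer.Rank1Residual

set_option autoImplicit false

namespace Summit.BirchSwinnertonDyer.Rank1Residual.P2

/-! ### `1323a1` over `ℚ(√−47)`: `d = 61` -/

/-- **`61 ∈ 𝒩(1323a1, ℚ(√−47))`**, decided in the kernel: `61` is prime, `≡ 1 (mod 4)`, `∉ {2, 3, 7}`,
`(−47/61) = 1`, and `x³ = −16·2401` has NO root in `𝔽₆₁` (so `a₆₁(1323a1)` is odd).
[cite: KrizLi2019, Def. 4.1 (FMS) = arXiv Def. 3.1] -/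
theorem inN_sixtyOne_curve1323a1 : KrizLi2019.InN curve1323a1 (sqrtField (-47)) 61 :=
  inN_curve1323a1_of_explicit (sqrtField.finrank_eq_two (-47)) (d := 61) (by norm_num)
    (by exact (Nat.prime_iff.1 (by norm_num)).squarefree)
    (fun ℓ hℓ hℓd => by
      have h : ℓ ∣ 61 := by simpa using hℓd
      obtain rfl := (Nat.prime_dvd_prime_iff_eq hℓ (by norm_num)).mp h
      have key : Even ((Finset.univ.filter fun x : ZMod 61 =>
          x ^ 3 = -(16 * (4 * (600 : ZMod 61) + 1))).card) := by decide
      rw [isImaginaryQuadratic_and_discr_sqrtField_neg_fortySeven.2]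
      exact ⟨by norm_num, by norm_num, by norm_num, by norm_num, key⟩)

/-- **`BSD(W′, 2)` for every globally minimal `W′` `ℚ`-isogenous to `1323a1^{(61)}` or to
`1323a1^{(−47·61)}`**, granted BY NAME the seven facts and the DISPLAYED (★)-datum of `(1323a1, ℚ(√−47))`;
the membership `61 ∈ 𝒩`, the sign `χ₆₁(−N) = 1` and every other Kriz–Li hypothesis of the base decided or
proved in the kernel. [cite: KrizLi2019, Thm. 5.1 (2), Def. 4.1, §6 Ex. 6.2] [cite: CreutzMiller2012, Thm. 1.1]
[cite: BurungaleFlach2024, Thm. 1.1 and Cor. 2] [cite: MilneADT2006, Thm. I.7.3] -/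
theorem bsdp_two_twist_sixtyOne_curve1323a1 (hKL : KrizLi2019.thm112_bsdTwo_twist)
    (h33 : KrizLi2019.thm33_rank_twist) (hS31 : bsdTriple_of_analyticRank_le_one_of_conductor_lt)
    (hBF : bsdTriple_of_hasCM_of_L_one_ne_zero) (hmod : hasEntireLFunction_rat)
    (hGZK : rank_eq_analyticRank_of_analyticRank_le_one) (hCassels : bsdRHS_eq_of_isIsogenous)
    (hSD : HasKrizLiStarDatum curve1323a1 (sqrtField (-47)))
    (W' : WeierstrassCurve ℚ) [W'.IsElliptic] [W'.IsGloballyMinimal]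
    (hiso : IsIsogenous W' (curve1323a1.quadraticTwist ((61 : ℤ) : ℚ)) ∨
      IsIsogenous W' (curve1323a1.quadraticTwist ((-47 * 61 : ℤ) : ℚ))) : BSDp W' 2 :=
  bsdp_two_of_isIsogenousToKrizLiTwistOfSmallCMBase hKL h33 hS31 hBF hmod hGZK hCassels W'
    (isIsogenousToKrizLiTwistOfSmallCMBase_of_curve1323a1_of_discr_eq
      isImaginaryQuadratic_and_discr_sqrtField_neg_fortySeven.1
      isImaginaryQuadratic_and_discr_sqrtField_neg_fortySeven.2 hSD inN_sixtyOne_curve1323a1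
      (by norm_num) (by norm_num) (by norm_num) hiso)

/-- **The analytic ranks of the two explicit twists**: `r_an = 1` on every globally minimal `ℚ`-model of
`1323a1^{(61)}` and `r_an = 0` on every one of `1323a1^{(-47·61)}`, granted BY NAME Kriz–Li Thm 4.3, the
CM converse fact `hBF`, modularity and the DISPLAYED (★)-datum. [cite: KrizLi2019, Thm. 4.3 (FMS) = arXiv Thm. 3.3] -/
theorem analyticRank_twist_sixtyOne_curve1323a1 (h33 : KrizLi2019.thm33_rank_twist)
    (hBF : bsdTriple_of_hasCM_of_L_one_ne_zero) (hmod : hasEntireLFunction_rat)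
    (hSD : HasKrizLiStarDatum curve1323a1 (sqrtField (-47)))
    (W₁ W₂ : WeierstrassCurve ℚ) [W₁.IsElliptic] [W₁.IsGloballyMinimal] [W₂.IsElliptic] [W₂.IsGloballyMinimal]
    (hW₁ : ∃ C : VariableChange ℚ, C • curve1323a1.quadraticTwist ((61 : ℤ) : ℚ) = W₁)
    (hW₂ : ∃ C : VariableChange ℚ, C • curve1323a1.quadraticTwist ((-47 * 61 : ℤ) : ℚ) = W₂) :
    W₁.analyticRank = 1 ∧ W₂.analyticRank = 0 := by
  have hK := isImaginaryQuadratic_and_discr_sqrtField_neg_fortySeven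
  have e : ((61 * NumberField.discr (sqrtField (-47)) : ℤ) : ℚ) = ((-47 * 61 : ℤ) : ℚ) := by
    rw [hK.2]; norm_num
  exact analyticRank_of_twist_of_hasKrizLiStarDatum curve1323a1 h33 hBF hmod (hasCM_cubicA₃ 600)
    one_le_mordellWeilRank_curve1323a1 (twoTorsion_cubicA₃ 600) (sqrtField (-47)) hK.1
    (satisfiesHeegnerHypothesis_curve1323a1_of_discr_eq (sqrtField.finrank_eq_two (-47)) hK.2) hSD
    inN_sixtyOne_curve1323a1
    (sign_mul_jacobiSym_conductorNorm_curve1323a1 (by norm_num) (by norm_num) (by norm_num))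
    W₁ W₂ hW₁ (by rw [e]; exact hW₂)

/-! ### `1323m1` over `ℚ(√−47)`: `d = 61` -/

/-- **`61 ∈ 𝒩(1323m1, ℚ(√−47))`**, decided in the kernel (`x³ = 112` has no root in `𝔽₆₁`: `112` and
`−16·2401` are both `14` times a cube). [cite: KrizLi2019, Def. 4.1 (FMS) = arXiv Def. 3.1] -/
theorem inN_sixtyOne_curve1323m1 : KrizLi2019.InN curve1323m1 (sqrtField (-47)) 61 :=
  inN_curve1323m1_of_explicit (sqrtField.finrank_eq_two (-47)) (d := 61) (by norm_num)
    (by exact (Nat.prime_iff.1 (by norm_num)).squarefree)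
    (fun ℓ hℓ hℓd => by
      have h : ℓ ∣ 61 := by simpa using hℓd
      obtain rfl := (Nat.prime_dvd_prime_iff_eq hℓ (by norm_num)).mp h
      have key : Even ((Finset.univ.filter fun x : ZMod 61 =>
          x ^ 3 = -(16 * (4 * (-2 : ZMod 61) + 1))).card) := by decide
      rw [isImaginaryQuadratic_and_discr_sqrtField_neg_fortySeven.2]
      exact ⟨by norm_num, by norm_num, by norm_num, by norm_num, key⟩)

/-- **`BSD(W′, 2)` for every globally minimal `W′` `ℚ`-isogenous to `1323m1^{(61)}` or to
`1323m1^{(−47·61)}`**, granted BY NAME the seven facts and the DISPLAYED (★)-datum of `(1323m1, ℚ(√−47))`.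
[cite: KrizLi2019, Thm. 5.1 (2), Def. 4.1, §6 Ex. 6.2] [cite: CreutzMiller2012, Thm. 1.1]
[cite: BurungaleFlach2024, Thm. 1.1 and Cor. 2] [cite: MilneADT2006, Thm. I.7.3] -/
theorem bsdp_two_twist_sixtyOne_curve1323m1 (hKL : KrizLi2019.thm112_bsdTwo_twist)
    (h33 : KrizLi2019.thm33_rank_twist) (hS31 : bsdTriple_of_analyticRank_le_one_of_conductor_lt)
    (hBF : bsdTriple_of_hasCM_of_L_one_ne_zero) (hmod : hasEntireLFunction_rat)
    (hGZK : rank_eq_analyticRank_of_analyticRank_le_one) (hCassels : bsdRHS_eq_of_isIsogenous)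
    (hSD : HasKrizLiStarDatum curve1323m1 (sqrtField (-47)))
    (W' : WeierstrassCurve ℚ) [W'.IsElliptic] [W'.IsGloballyMinimal]
    (hiso : IsIsogenous W' (curve1323m1.quadraticTwist ((61 : ℤ) : ℚ)) ∨
      IsIsogenous W' (curve1323m1.quadraticTwist ((-47 * 61 : ℤ) : ℚ))) : BSDp W' 2 :=
  bsdp_two_of_isIsogenousToKrizLiTwistOfSmallCMBase hKL h33 hS31 hBF hmod hGZK hCassels W'
    (isIsogenousToKrizLiTwistOfSmallCMBase_of_curve1323m1_of_discr_eq
      isImaginaryQuadratic_and_discr_sqrtField_neg_fortySeven.1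
      isImaginaryQuadratic_and_discr_sqrtField_neg_fortySeven.2 hSD inN_sixtyOne_curve1323m1
      (by norm_num) (by norm_num) (by norm_num) hiso)

/-- **The analytic ranks of the two explicit twists**: `r_an = 1` on every globally minimal `ℚ`-model of
`1323m1^{(61)}` and `r_an = 0` on every one of `1323m1^{(-47·61)}`, granted BY NAME Kriz–Li Thm 4.3, the
CM converse fact `hBF`, modularity and the DISPLAYED (★)-datum. [cite: KrizLi2019, Thm. 4.3 (FMS) = arXiv Thm. 3.3] -/
theorem analyticRank_twist_sixtyOne_curve1323m1 (h33 : KrizLi2019.thm33_rank_twist)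
    (hBF : bsdTriple_of_hasCM_of_L_one_ne_zero) (hmod : hasEntireLFunction_rat)
    (hSD : HasKrizLiStarDatum curve1323m1 (sqrtField (-47)))
    (W₁ W₂ : WeierstrassCurve ℚ) [W₁.IsElliptic] [W₁.IsGloballyMinimal] [W₂.IsElliptic] [W₂.IsGloballyMinimal]
    (hW₁ : ∃ C : VariableChange ℚ, C • curve1323m1.quadraticTwist ((61 : ℤ) : ℚ) = W₁)
    (hW₂ : ∃ C : VariableChange ℚ, C • curve1323m1.quadraticTwist ((-47 * 61 : ℤ) : ℚ) = W₂) :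
    W₁.analyticRank = 1 ∧ W₂.analyticRank = 0 := by
  have hK := isImaginaryQuadratic_and_discr_sqrtField_neg_fortySeven
  have e : ((61 * NumberField.discr (sqrtField (-47)) : ℤ) : ℚ) = ((-47 * 61 : ℤ) : ℚ) := by
    rw [hK.2]; norm_num
  exact analyticRank_of_twist_of_hasKrizLiStarDatum curve1323m1 h33 hBF hmod (hasCM_cubicA₃ (-2))
    one_le_mordellWeilRank_curve1323m1 (twoTorsion_cubicA₃ (-2)) (sqrtField (-47)) hK.1
    (satisfiesHeegnerHypothesis_curve1323m1_of_discr_eq (sqrtField.finrank_eq_two (-47)) hK.2) hSD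
    inN_sixtyOne_curve1323m1
    (sign_mul_jacobiSym_conductorNorm_curve1323m1 (by norm_num) (by norm_num) (by norm_num))
    W₁ W₂ hW₁ (by rw [e]; exact hW₂)

/-! ### `4563a1` over `ℚ(√−23)`: `d = 193` -/

/-- **`193 ∈ 𝒩(4563a1, ℚ(√−23))`**, decided in the kernel: `193` is prime, `≡ 1 (mod 4)`, `∉ {2, 3, 13}`,
`(−23/193) = 1`, and `x³ = −16·13⁵` has NO root in `𝔽₁₉₃` (`a₁₉₃(4563a1)` odd). It is the least such prime
`≡ 1 (mod 12)`. [cite: KrizLi2019, Def. 4.1 (FMS) = arXiv Def. 3.1] -/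
theorem inN_oneNinetyThree_curve4563a1 : KrizLi2019.InN curve4563a1 (sqrtField (-23)) 193 :=
  inN_curve4563a1_of_explicit (sqrtField.finrank_eq_two (-23)) (d := 193) (by norm_num)
    (by exact (Nat.prime_iff.1 (by norm_num)).squarefree)
    (fun ℓ hℓ hℓd => by
      have h : ℓ ∣ 193 := by simpa using hℓd
      obtain rfl := (Nat.prime_dvd_prime_iff_eq hℓ (by norm_num)).mp h
      have key : Even ((Finset.univ.filter fun x : ZMod 193 =>
          x ^ 3 = -(16 * (4 * (92823 : ZMod 193) + 1))).card) := by decide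
      rw [isImaginaryQuadratic_and_discr_sqrtField_neg_twentyThree.2]
      exact ⟨by norm_num, by norm_num, by norm_num, by norm_num, key⟩)

/-- **`BSD(W′, 2)` for every globally minimal `W′` `ℚ`-isogenous to `4563a1^{(193)}` or to
`4563a1^{(−23·193)}`**, granted BY NAME the seven facts and the DISPLAYED (★)-datum of `(4563a1, ℚ(√−23))`.
[cite: KrizLi2019, Thm. 5.1 (2), Def. 4.1, §6 Ex. 6.2] [cite: CreutzMiller2012, Thm. 1.1]
[cite: BurungaleFlach2024, Thm. 1.1 and Cor. 2] [cite: MilneADT2006, Thm. I.7.3] -/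
theorem bsdp_two_twist_oneNinetyThree_curve4563a1 (hKL : KrizLi2019.thm112_bsdTwo_twist)
    (h33 : KrizLi2019.thm33_rank_twist) (hS31 : bsdTriple_of_analyticRank_le_one_of_conductor_lt)
    (hBF : bsdTriple_of_hasCM_of_L_one_ne_zero) (hmod : hasEntireLFunction_rat)
    (hGZK : rank_eq_analyticRank_of_analyticRank_le_one) (hCassels : bsdRHS_eq_of_isIsogenous)
    (hSD : HasKrizLiStarDatum curve4563a1 (sqrtField (-23)))
    (W' : WeierstrassCurve ℚ) [W'.IsElliptic] [W'.IsGloballyMinimal]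
    (hiso : IsIsogenous W' (curve4563a1.quadraticTwist ((193 : ℤ) : ℚ)) ∨
      IsIsogenous W' (curve4563a1.quadraticTwist ((-23 * 193 : ℤ) : ℚ))) : BSDp W' 2 :=
  bsdp_two_of_isIsogenousToKrizLiTwistOfSmallCMBase hKL h33 hS31 hBF hmod hGZK hCassels W'
    (isIsogenousToKrizLiTwistOfSmallCMBase_of_curve4563a1_of_discr_eq
      isImaginaryQuadratic_and_discr_sqrtField_neg_twentyThree.1
      isImaginaryQuadratic_and_discr_sqrtField_neg_twentyThree.2 hSD inN_oneNinetyThree_curve4563a1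
      (by norm_num) (by norm_num) (by norm_num) hiso)

/-- **The analytic ranks of the two explicit twists**: `r_an = 1` on every globally minimal `ℚ`-model of
`4563a1^{(193)}` and `r_an = 0` on every one of `4563a1^{(-23·193)}`, granted BY NAME Kriz–Li Thm 4.3, the
CM converse fact `hBF`, modularity and the DISPLAYED (★)-datum. [cite: KrizLi2019, Thm. 4.3 (FMS) = arXiv Thm. 3.3] -/
theorem analyticRank_twist_oneNinetyThree_curve4563a1 (h33 : KrizLi2019.thm33_rank_twist)
    (hBF : bsdTriple_of_hasCM_of_L_one_ne_zero) (hmod : hasEntireLFunction_rat)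
    (hSD : HasKrizLiStarDatum curve4563a1 (sqrtField (-23)))
    (W₁ W₂ : WeierstrassCurve ℚ) [W₁.IsElliptic] [W₁.IsGloballyMinimal] [W₂.IsElliptic] [W₂.IsGloballyMinimal]
    (hW₁ : ∃ C : VariableChange ℚ, C • curve4563a1.quadraticTwist ((193 : ℤ) : ℚ) = W₁)
    (hW₂ : ∃ C : VariableChange ℚ, C • curve4563a1.quadraticTwist ((-23 * 193 : ℤ) : ℚ) = W₂) :
    W₁.analyticRank = 1 ∧ W₂.analyticRank = 0 := by
  have hK := isImaginaryQuadratic_and_discr_sqrtField_neg_twentyThree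
  have e : ((193 * NumberField.discr (sqrtField (-23)) : ℤ) : ℚ) = ((-23 * 193 : ℤ) : ℚ) := by
    rw [hK.2]; norm_num
  exact analyticRank_of_twist_of_hasKrizLiStarDatum curve4563a1 h33 hBF hmod (hasCM_cubicA₃ 92823)
    one_le_mordellWeilRank_curve4563a1 (twoTorsion_cubicA₃ 92823) (sqrtField (-23)) hK.1
    (satisfiesHeegnerHypothesis_curve4563a1_of_discr_eq (sqrtField.finrank_eq_two (-23)) hK.2) hSD
    inN_oneNinetyThree_curve4563a1
    (sign_mul_jacobiSym_conductorNorm_curve4563a1 (by norm_num) (by norm_num) (by norm_num))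
    W₁ W₂ hW₁ (by rw [e]; exact hW₂)

end Summit.BirchSwinnertonDyer.Rank1Residual.P2

end
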